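import Mathlib
import Literature.MathematicalPhysics.QuantumLattice.KohnLuttinger
import HarnessLib

/-!
# Crux `CwThesis` (stmt-HubbardSuperconductivity-10438, route `ChiralWindow`), line
`SketchIdeator3` (v5 anchor branch) — stub `stub_modulatedChannelState`

Helper for the Riemann–Lebesgue proviso of the v5 anchor: **modulated channel states.**
Multiplying a channel state `ψ` (`IsChannelState ε μ χ ψ`: square integrable for the Fermi-curve
measure `μ_F`, of unit `L²(μ_F)`-norm, and fixed by the isotypic projector `d4Project χ`) by a
measurable, `D₄`-invariant function `m` with `m² = 1` pointwise gives again a channel state: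

* `|m k| = 1`, so `‖m k · ψ k‖ = ‖ψ k‖` and `m ψ ∈ L²(μ_F)` (`MemLp.of_le`);
* `(m k · ψ k)² = (m k)² (ψ k)² = (ψ k)²`, so the normalisation is unchanged;
* `d4Project χ (m ψ) k = (dim χ / 8) Σ_γ χ(γ) m(γ k) ψ(γ k) = m k · d4Project χ ψ k = m k · ψ k`
  by the `D₄`-invariance of `m`.

No definition is introduced. [folklore]
-/

noncomputable section

namespace Summit.HubbardSuperconductivity.HubbardSuperconductivity.Theorems.CwThesis

set_option linter.dupNamespace false
-- the tree's namespace repeats the summit name by design (D-0017)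

open MeasureTheory Literature.MathematicalPhysics.QuantumLattice

/-- A real function with `m² = 1` pointwise has `|m| = 1` pointwise. [folklore] -/
theorem abs_eq_one_of_sq_eq_one {m : Momentum → ℝ} (hm1 : ∀ k, m k ^ 2 = 1) (k : Momentum) :
    |m k| = 1 := by
  rcases sq_eq_one_iff.1 (hm1 k) with h | h
  · rw [h, abs_one]
  · rw [h, abs_neg, abs_one]

/-- The isotypic projection commutes with multiplication by a `D₄`-invariant function:
`d4Project χ (m ψ) k = m k · d4Project χ ψ k`. [folklore] -/
theorem d4Project_mul_of_invariant (χ : D4Irrep) {m : Momentum → ℝ} (ψ : Momentum → ℝ)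
    (hminv : ∀ (g : DihedralGroup 4) (k : Momentum), m (d4Momentum g k) = m k) (k : Momentum) :
    d4Project χ (fun k => m k * ψ k) k = m k * d4Project χ ψ k := by
  simp only [d4Project]
  rw [Finset.mul_sum, Finset.mul_sum, Finset.mul_sum]
  refine Finset.sum_congr rfl fun γ _ => ?_
  rw [hminv γ k]
  ring

/-- **Modulated channel states.** Multiplying a channel state `ψ` (`IsChannelState ε μ χ ψ`:
`L²(μ_F)`, unit norm, `d4Project χ ψ = ψ`) by a measurable, `D₄`-invariant function `m` with
`m² = 1` gives a channel state: `|m ψ| = |ψ|` pointwise, and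
`d4Project χ (m ψ) k = (dim χ / 8) Σ_γ χ(γ) m(γ k) ψ(γ k) = m k · d4Project χ ψ k`. [folklore] -/
theorem stub_modulatedChannelState {ε : Momentum → ℝ} {μ : ℝ} {χ : D4Irrep} {ψ m : Momentum → ℝ}
    (hψ : IsChannelState ε μ χ ψ) (hm : Measurable m) (hm1 : ∀ k, m k ^ 2 = 1)
    (hminv : ∀ (g : DihedralGroup 4) (k : Momentum), m (d4Momentum g k) = m k) :
    IsChannelState ε μ χ (fun k => m k * ψ k) := by
  obtain ⟨hmem, hnorm, hch⟩ := hψ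
  refine ⟨?_, ?_, ?_⟩
  · -- square integrability: `‖m k * ψ k‖ = ‖ψ k‖`
    refine MemLp.of_le hmem (hm.aestronglyMeasurable.mul hmem.1)
      (Filter.Eventually.of_forall fun k => ?_)
    rw [norm_mul, Real.norm_eq_abs (m k), abs_eq_one_of_sq_eq_one hm1 k, one_mul]
  · -- normalisation: `(m k * ψ k)² = ψ k²`
    have hfun : (fun k => (m k * ψ k) ^ 2) = fun k => ψ k ^ 2 := by
      funext k
      rw [mul_pow, hm1 k, one_mul]
    simp only []
    rw [hfun]
    exact hnorm
  · -- the channel condition: pull the invariant factor `m k` out of the isotypic sum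
    unfold InChannel at hch ⊢
    funext k
    rw [d4Project_mul_of_invariant χ ψ hminv k, congrFun hch k]

end Summit.HubbardSuperconductivity.HubbardSuperconductivity.Theorems.CwThesis

end
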